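import Mathlib
import HarnessLib
import HarnessLib.Audit
import Summits.AtomisticToContinuum.Statement

/-!
Route: SuperadditiveJunction

CLOSED (retired) 2026-08-15T13:47:14Z by operator:999:1257524 — reason: not-a-thesis: assembly does not conclude the sub-problem Statement — note: D-0027 §2.1 audit (human 2026-08-15: routes that do not decide the summit are removed): the assembly concludes `Literature.MathematicalPhysics.KineticTheory.HeatConduction.FouriersLaw`, not the sub-problem statement; a NEW conforming route may be opened from the same idea (generated `closes : … → _r. The file is kept as the record of this route; refuted decls are indexed as negative knowledge (`ledger negatives`).

X_SJ (JUNCTION LOCALITY; idea card superadditive-junction-dichotomy; "it suffices to show"): fix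
pinnedChain ω₂ lam β γ (all four > 0) and T > 0; let D_N(T) = lim_{δ→0, δ≠0}
totalCurrent(μ_{N,T+δ/2,T−δ/2})/δ be the finite-N response coefficient of clause (ii) of
OscillatorChain.FouriersLawFor along the (unique) weak steady-state family, and R_N := (N−1)/D_N (N
≥ 2) the end-to-end linear-response RESISTANCE (= δT/J_N, since totalCurrent = (N−1)·J_N). Show:
 (S) [support, shared] weak steady states exist and are unique (NessExistsUnique =
stmt-AtomisticToContinuum-0706) and D_N exists (FiniteResponseOfUnique = stmt-0717); [support] D_N >
0 for N ≥ 2 (PositiveConductance).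
 (A) [crux, rank 2] SUPERADDITIVE RESISTANCE: ∃ C(T) ∀ N, M ≥ 2: R_{N+M} ≥ R_N + R_M − C. Since R_N
+ R_M is EXACTLY the resistance of the cut system — bond (N−1,N) removed, both new ends terminated
by Langevin baths at the common self-consistent temperature (series law = current matching at linear
response, pure algebra) — (A) says: cutting the chain and re-thermalising the cut raises the
end-to-end resistance by at most a contact constant (bounded reservoir-insertion cost; Matthiessen
direction). It holds with room in the ballistic (R_N bounded), diffusive (R_N = N/κ + 2ρ_contact +
o(1)) and localised (R_N ~ e^{cN}) regimes and FAILS exactly for superdiffusive transport (R_{2N} =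
2^{1−α}R_N: a thermalising cut destroys the long-range current correlations), the regime pinning is
believed to exclude.
 (B) [crux, rank 3] NOT BALLISTIC: liminf_N D_N/(N−1) = 0 — the conductance J_N/δT is not bounded
away from 0. NECESSARY for the conjunct (FouriersLawFor ⇒ HasBoundedResponse ⇒ D_N/(N−1) → 0). Given
(A) with an explicit C(T), (B) ⟺ ONE length N₀ with R_{N₀}(T) > C(T): a single finite-size
certificate (certified two-sided bounds on D_{N₀} for a 2N₀-dimensional hypoelliptic polynomial
diffusion), exactly as finite-size criteria work in percolation/Ising.
 (C) [crux, rank 4] NOT INSULATING: liminf_N D_N > 0. NECESSARY for the conjunct.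
GLUE (Assembly; pure logic + the real-analysis support lemma SuperadditiveFekete): a_N := R_N − C is
superadditive on {N ≥ 2}; (A)+(B) give N₀ with a_{N₀} > 0; (C) gives a_N/N ≤ 1/c eventually; Fekete
on {N ≥ 2} (N = qm + r, r ∈ {2,…,m+1}) gives R_N/N → ℓ = sup_N a_N/N ∈ (0, 1/c], hence D_N =
(N−1)/R_N → κ(T) := 1/ℓ ∈ [c, ∞) — existence AND finiteness of the limit from a sign plus one
number; weak-NESS uniqueness transfers the response limits to every steady-state family (as in
hasBoundedResponse_iff_of_unique); with (S) this is FouriersLawFor for every parameter point, i.e.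
FouriersLaw (landed frame fouriersLaw_of_steadyState_and_linearResponse).
BY-PRODUCT (support items JunctionDichotomy, QuasiSubadditiveResistance — shared with route
FeketeResistance as its crux stmt-2186 —, HarmonicCalibration): two-sided junction locality |R_{N+M}
− R_N − R_M| ≤ C forces |R_N − Nℓ| ≤ C for all N, hence the DICHOTOMY — either ℓ = 0 and D_N ≥
(N−1)/C for every N (ballistic branch: the pinned harmonic chain pinnedChain ω₂ 0 0 γ, which
satisfies two-sided locality and violates exactly (B)), or ℓ > 0 and |D_N − κ| ≤ K/N (Fourier's law
WITH the 1/N finite-size rate); anomalous scalings D_N ~ N^α, 0 < α < 1, are excluded structurally.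
(A) is therefore NOT a consequence of the conjunct: it carries rate information, and that is the
bet.
Lean (elaborates; decls of this file, no new definitions — R_N is a quotient of the statement's own
D_N, all items conditioned on weak-NESS uniqueness so D_N is canonical): Assembly : NessExistsUnique
→ FiniteResponseOfUnique → PositiveConductance → ConductanceLowerBound → SuperadditiveResistance →
NonBallistic → Literature.MathematicalPhysics.KineticTheory.HeatConduction.FouriersLaw.

Rationale: WHY THIS LINE. Every route to clause (ii) must control "the dependence of D on L"
(BonettoLebowitzReyBellet2000 §6.3; barrier HasBoundedResponse, necessary by
hasBoundedResponse_of_fouriersLawFor). Instead of an N-uniform analytic estimate on ONE chain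
(Green–Kubo decay, hypocoercive rates, hydrodynamic closure — open or catalogued as blocked), this
line compares THREE finite chains (N, M, N+M) that differ by a local surgery and lets
superadditivity manufacture the N → ∞ statement (Fekete). Imported areas, with dictionary: (i)
finite-size criteria / superadditive ergodic architecture of percolation and stochastic
homogenisation (Hammersley1988 mesoadditivity ⇒ specific conductivity exists;
ArmstrongKuusiMourrat2019 Ch. 2: box U ↦ segment, dual superadditive quantity ν* ↦ R_N − C, 'one
good box' ↦ one N₀ with R_{N₀} > C); (ii) mesoscopic series resistors with a thermalising/dephasing
probe (Buttiker1986: a phase-randomising reservoir restores Ohmic series addition up to a contact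
term; BodineauDerrida2004 additivity principle = the large-deviation cousin, composing segments
through an optimised junction temperature; self-consistent reservoirs
BonettoLebowitzLukkarinenOlla2009); (iii) as proof arena for (A): two-sided Dirichlet/Thomson
(saddle) representations of D_N = T⁻²⟨J,(−L)⁻¹J⟩ for the non-reversible hypoelliptic generator L =
A_H + γS (GaudilliereLandim2013, LandimMarianiSeo2018; finite-volume Kubo formula ReyBellet2003 Rem
4.4, KunduDharNarayan2009; admissible-class caveat arXiv:1105.0493 §6) plus a JUNCTION-REPAIR step
on O(1) sites — superadditivity is an UPPER bound on the conductance of the joined chain from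
near-optimal test objects of the two bathed halves; (iv) certified computation (moment/SOS bounds on
stationary averages of polynomial diffusions, doi:10.1137/16m107801x, doi:10.1137/15m1053347) for
the single certificate in (B). BLR's order of limits is kept (δ → 0 at fixed N first); no
infinite-volume dynamics, no local equilibrium, no relaxation rate, no κ = κ_GK identification is
used — this is what separates the line from route FourierGreenKubo. Cruxes (B), (C) are NECESSARY
conditions (the 'not ballistic' / 'not insulating' halves of 0 < κ < ∞), so all risk beyond the
conjunct itself sits in (A), whose payoff is existence + finiteness of lim D_N from a sign and one
number.
RANKED CRUXES. rank 2 SuperadditiveResistance (A): the bet; might fail if the junction-repair cost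
grows with N, M (junction-crossing coherent structure of optimal response fields; long mean free
path — C(T) ↑ ∞ as T → 0 is allowed and expected, κ ~ (lam T)⁻²), and no sign principle is known
(dephasing-assisted transport exists elsewhere). rank 3 NonBallistic (B): necessary; no theorem
gives J_N → 0 for any deterministic anharmonic chain, but given an explicit C from (A) it is ONE
certified finite-N₀ inequality; a hidden conserved quantity would falsify it AND the conjunct. rank
4 ConductanceLowerBound (C): necessary; no N-uniform lower bound on the NESS current of a
deterministic anharmonic chain is in print (candidate engines: fluctuation-theorem/TUR conductance
bounds, comparison, multi-scale pigeonhole — sibling idea cards).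
SUPPORT (not staffed). NessExistsUnique (0706) and FiniteResponseOfUnique (0717) shared verbatim
with FourierGreenKubo; PositiveConductance (finite-N Kubo variance > 0); SuperadditiveFekete
(abstract real analysis the Assembly proof needs); JunctionDichotomy (abstract: two-sided locality ⇒
1/N rate or ballistic — the refutation interface: published pinned-chain numerics show 1/N
finite-size corrections); QuasiSubadditiveResistance (companion half = crux stmt-2186 of the
concurrently opened route FeketeResistance, shared verbatim; with PositiveConductance it also yields
(C): R_N ≤ KN ⇒ D_N ≥ 1/(2K)); PositiveConductance is likewise shared (stmt-2188);
HarmonicCalibration (pinnedChain ω₂ 0 0 γ along harmonicNESS: two-sided locality holds and R_N =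
1/fluxCoeff_N is bounded, so exactly (B) fails at the integrable corner — sign/normalisation
regression test provable from HarmonicChainBallisticFlux_holds, fluxCoeff_eq, tendsto_fluxCoeff,
integral_bondCurrent_harmonicNESS_eq_fluxCoeff).
KILL CRITERIA. (A) dies if nonequilibrium simulations of pinnedChain 1 1 1 1 (T ∈ {0.1, 1, 10}, N =
M = 2^k ≤ 128) show Δ_k := R_{2N} − 2R_N → −∞, equivalently finite-size corrections |D_N − κ|
decaying slower than 1/N, or if a theorem exhibits superdiffusive enhancement / log-growing contact
layers in a pinned chain (then only a C = o(N) variant survives — a different route). (B) refuted ⇒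
hidden conserved quantity ⇒ file ¬FouriersLaw (pattern
HarmonicChainBallisticFlux.not_fouriersLawFor); (C) refuted ⇒ insulator ⇒ ¬FouriersLaw.
NOT DECOMPOSED YET. The saddle representation and the junction-repair lemma inside (A) (split
candidates SaddleRepresentation / JunctionRepair / ContactBound once a prover engages); the
certificate technology for (B); the engine for (C). No separate Target item: X is the conjunction of
the six Assembly hypotheses (D-0019 thin shape; a rank-0 conjunction would only restate them).
SOURCES. BonettoLebowitzReyBellet2000 §5.3 (33), §6.3; LepriLiviPoliti2003 §6; Dhar2008 §3.5, §9;
Buttiker1986; BodineauDerrida2004; BonettoLebowitzLukkarinenOlla2009; BonettoLebowitzLukkarinen2004;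
Hammersley1988; ArmstrongKuusiMourrat2019 Ch. 2; GaudilliereLandim2013; LandimMarianiSeo2018;
arXiv:1105.0493 §6; ReyBellet2003 Rem 4.4 (56); KunduDharNarayan2009; RoyDhar2008 §2 (2.8);
CuneoEckmannHairerReyBellet2018 Thm 2.13; doi:10.1137/16m107801x; doi:10.1137/15m1053347;
CanestrariLiveraniOlla2026 §1; Mazur1969; DeRoeckHuveneers2015.

Novelty: NOVELTY (searches run 2026-08-15 by this planner: lit frontier AtomisticToContinuum --since 2020
(only deterministic-bulk advance arXiv:2310.13338 = CanestrariLiveraniOlla2026, mesoscopic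
stochastic limit, unrelated mechanism); lit bridges --cross any (nothing on series laws); lit search
crossref 'superadditive subadditive thermal resistance system size anharmonic chain existence of
conductivity' and 'lower bound thermal conductivity anharmonic chain nonequilibrium stationary state
uniform in size' (0 relevant); lit search --hybrid 'resistance of two chains in series intermediate
reservoir contact resistance additivity heat conduction' (engineering textbooks only); plus the two
refuter novelty audits of the card and of its siblings (hybrid ×2, crossref ×8, galaxy ×3,
saturated), whose prior-art list is adopted). Nearest prior art: (1) 'superadditive/mesoadditive +
one finite-size witness ⇒ linear growth / limit exists' as proof architecture for conductivity-type
quantities — Hammersley1988 (doi:10.1017/s002190020004047x), Grimmett–Kesten 1984,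
ArmstrongKuusiMourrat2019 Ch. 2 (dual quantity ν*), Giunti–Gu–Mourrat / Funaki–Gu–Wang for
reversible particle systems — all reversible/elliptic, nested variational classes; (2) 'insert a
thermalising reservoir, pay a contact resistance': Buttiker1986 (doi:10.1103/physrevb.33.3020),
D'Amato–Pastawski 1990, BodineauDerrida2004 additivity principle (doi:10.1103/physrevlett.92.180601,
physics, presupposes diffusivity), self-consistent rese  [refs: 10.1017/s002190020004047x, 10.1103/physrevb.33.3020, 10.1103/physrevlett.92.180601, 2310.13338, doi:10.1017/s002190020004047x, doi:10.1103/physrevb.33.3020, doi:10.1103/physrevlett.92.180601, CanestrariLiveraniOlla2026, Hammersley1988, ArmstrongKuusiMourrat2019, Buttiker1986, BodineauDerrida2004, BonettoLebowitzLukkarinen2004, BonettoLebowitzLukkarinenOlla2009, GaudilliereLandim2013, LandimMariani]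

Barriers (technique_class: superadditivity-in-length junction-repair finite-size-test): technique_class: superadditivity-in-length junction-repair finite-size-test
- Literature.Barriers.AtomisticToContinuum.HasBoundedResponse (FixedLengthNoConductivityControl;
fixed-N class): the universal residual crux is REPLACED, not assumed — (A) relates three lengths and
Fekete manufactures the N → ∞ statement; the only fixed-N ingredient is ONE certified N₀ in (B),
legitimate fixed-N analysis used once, not uniformly; (B) and (C) are necessary consequences of the
conjunct, so the route cannot be weaker than it must be there.
- Literature.Barriers.AtomisticToContinuum.HarmonicChainBallisticFlux (anharmonicity-free class):
consistent and used as calibration — the harmonic member satisfies (A) (indeed two-sided locality,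
R_N = 1/fluxCoeff_N bounded) and violates exactly (B); it is the ℓ = 0 branch of JunctionDichotomy
(support HarmonicCalibration), so the line cannot prove too much; every anharmonic input sits in
(B)/(C).
- Literature.Barriers.AtomisticToContinuum.LowTemperatureWeakAnharmonicity: nothing is perturbative
in (lam, β) or uniform in T — C(T) ↑ ∞ and N₀(T) ↑ ∞ as T → 0 are allowed (N₀ ~ mean free path ~
(lam T)⁻², matching κ ~ (lam T)⁻²); T is fixed throughout.
- Literature.Barriers.AtomisticToContinuum.LukkarinenSpohn2008_lemma41 (FPUBetaKineticAnomaly) and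
Literature.Barriers.AtomisticToContinuum.Mazur1969_inequality (MazurBoundBallistic): these name
exactly the regimes where (A) resp. (B) FAIL (superdiffusive enhancement makes a thermalising cut
costly; a conse

History (route lifecycle, newest last):
- 2026-08-15T11:02:28Z · rev 1: dropped SubadditiveResistance — share the companion (subadditive) half with route FeketeResistance (stmt-2186, opened concurrently) instead of keeping a textual variant (stmt-2194); no crux/as (planner-plancard-AtomisticToContinuum-Fourier-66d4262d-0)
- 2026-08-15T13:47:14Z · CLOSED retired — not-a-thesis: assembly does not conclude the sub-problem Statement (operator:999:1257524)

sub-problem: FouriersLaw · status: closed(retired) · opened planner-plancard-AtomisticToContinuum-Fourier-66d4262d-0 2026-08-15T11:01:32Z · rev 2 · ledger route-AtomisticToContinuum-SuperadditiveJunction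
GENERATED by the gate from the ledger (D-0016/17). Provers cite these decls: `theorem foo : Summit.AtomisticToContinuum.FouriersLaw.Theses.SuperadditiveJunction.<Decl> := …` in Summits/AtomisticToContinuum/FouriersLaw/Theorems/<Name>.lean.
-/

namespace Summit.AtomisticToContinuum.FouriersLaw.Theses.SuperadditiveJunction

open scoped BigOperators Topology Manifold Classical MeasureTheory ProbabilityTheory Matrix InnerProductSpace ComplexConjugate ContinuousMap
open Filter Set Function TopologicalSpace MeasureTheory

attribute [summit_statement] _root_.FouriersLaw

/-- item stmt-AtomisticToContinuum-2191 · crux · rank 2 · closed · moot by None · by planner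
why it might fail: Repair cost may grow with N,M if optimal response fields carry junction-crossing coherent structure at all scales (long mean free path; C(T)↑∞ as T→0 must be allowed); no sign principle (dephasing-assisted transport exists); variational classes are bulk-invariant (arXiv:1105.0493 §6).
sources: GaudilliereLandim2013, LandimMarianiSeo2018, arXiv:1105.0493, ReyBellet2003, KunduDharNarayan2009, Buttiker1986
[crux] SUPERADDITIVE RESISTANCE (junction locality; = InsertionCost of card
insertion-cost-superadditive-half): under weak-NESS uniqueness, for every steady-state family of
pinnedChain ω₂ lam β γ (all > 0), T > 0 and response coefficients D_N > 0 (N ≥ 2), ∃ C =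
C(ω₂,lam,β,γ,T): R_{N+M} ≥ R_N + R_M − C for all N, M ≥ 2, where R_N := (N−1)/D_N = δT/J_N is the
end-to-end linear-response resistance. R_N + R_M is exactly the resistance of the (N+M)-chain cut at
bond (N−1,N) with both new ends re-terminated by Langevin baths at the self-consistent temperature
(series law = current matching): a BOUNDED RESERVOIR-INSERTION COST. Proof arena: two-sided
Dirichlet/Thomson saddle representation of D_N = T⁻²⟨J,(−L)⁻¹J⟩, L = A_H + γS_baths
(GaudilliereLandim2013, LandimMarianiSeo2018; Kubo formula ReyBellet2003 Rem 4.4) + a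
JUNCTION-REPAIR lemma gluing near-optimal admissible pairs of the two bathed halves across the
deterministic bond at cost ≤ C uniformly in N, M (caveat arXiv:1105.0493 §6: admissible classes are
bulk-invariant). Other engines: thermostat interpolation at the junction; contact
cross-correlations. NOT implied by FouriersLaw (1/N-rate content): the bet. Trivial at lam = β = 0. -/
@[route_item "route-AtomisticToContinuum-SuperadditiveJunction"]
def SuperadditiveResistance : Prop :=
  ∀ ω₂ lam β γ : ℝ, 0 < ω₂ → 0 < lam → 0 < β → 0 < γ → (∀ (N : ℕ) (T_L T_R : ℝ), 0 < T_L → 0 < T_R → ∀ μ ν : MeasureTheory.Measure (Literature.MathematicalPhysics.KineticTheory.HeatConduction.PhaseSpace N), (Literature.MathematicalPhysics.KineticTheory.HeatConduction.pinnedChain ω₂ lam β γ).IsSteadyState N T_L T_R μ → (Literature.MathematicalPhysics.KineticTheory.HeatConduction.pinnedChain ω₂ lam β γ).IsSteadyState N T_L T_R ν → μ = ν) → ∀ μ : (N : ℕ) → ℝ → ℝ → MeasureTheory.Measure (Literature.MathematicalPhysics.KineticTheory.HeatConduction.PhaseSpace N), (∀ (N : ℕ) (T_L T_R : ℝ), 0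 < T_L → 0 < T_R → (Literature.MathematicalPhysics.KineticTheory.HeatConduction.pinnedChain ω₂ lam β γ).IsSteadyState N T_L T_R (μ N T_L T_R)) → ∀ T : ℝ, 0 < T → ∀ D : ℕ → ℝ, (∀ N : ℕ, Filter.Tendsto (fun δ : ℝ => (Literature.MathematicalPhysics.KineticTheory.HeatConduction.pinnedChain ω₂ lam β γ).totalCurrent (μ N (T + δ / 2) (T - δ / 2)) / δ) (nhdsWithin 0 {(0 : ℝ)}ᶜ) (nhds (D N))) → (∀ N : ℕ, 2 ≤ N → 0 < D N) → ∃ C : ℝ, ∀ N M : ℕ, 2 ≤ N → 2 ≤ M → ((N : ℝ) - 1) / D N + ((M : ℝ) - 1) / D M - C ≤ ((N : ℝ) + (M : ℝ) - 1) / D (N + M)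

/-- item stmt-AtomisticToContinuum-2192 · crux · rank 3 · closed · moot by None · by planner
why it might fail: A hidden conserved quantity / near-integrable member (Mazur1969; integrable dimer points) would make the chain a perfect conductor — then FouriersLaw is false too. Proof-wise nothing gives J_N→0 for ANY deterministic anharmonic chain (BLR2000 §6.3, CLO2026 §1); certificates need (A) explicit.
sources: BonettoLebowitzReyBellet2000, CanestrariLiveraniOlla2026, Mazur1969, RoyDhar2008, doi:10.1137/16m107801x, doi:10.1137/15m1053347
[crux] NOT BALLISTIC: under weak-NESS uniqueness, for every steady-state family of pinnedChain ω₂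
lam β γ (all > 0), T > 0 and the response coefficients D_N: for every ε > 0 there are arbitrarily
long chains with D_N ≤ ε(N−1), i.e. the conductance G_N = J_N/δT = D_N/(N−1) is not bounded away
from 0. NECESSARY for the conjunct (FouriersLawFor ⇒ HasBoundedResponse ⇒ G_N → 0): a refutation
refutes FouriersLaw itself (then file ¬FouriersLaw). Two ways in: (a) CERTIFICATE — once
SuperadditiveResistance holds with an explicit C(T), this item is equivalent (given D_N > 0) to ONE
N₀ ≥ 2 with (N₀−1)/D_{N₀}(T) > C(T), decidable by certified two-sided bounds on the stationary
linear response of a 2N₀-dimensional hypoelliptic polynomial diffusion (moment/SOS relaxations of ∫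
L f dμ = 0: doi:10.1137/16m107801x, doi:10.1137/15m1053347); by the scaling conjugacy D_N(T; lam, β)
= D_N(1; lam T, β T), N₀(T) → ∞ as T → 0 and '∀ T' needs compact-T families plus asymptotics; (b)
SOFT — an ergodic/entropy argument that ballistic conduction at every length forces a non-thermal
single-contact state (card single-thermostat-rigidity). Fails exactly for the harmonic member
(HarmonicCalibration). -/
@[route_item "route-AtomisticToContinuum-SuperadditiveJunction"]
def NonBallistic : Prop :=
  ∀ ω₂ lam β γ : ℝ, 0 < ω₂ → 0 < lam → 0 < β → 0 < γ → (∀ (N : ℕ) (T_L T_R : ℝ), 0 < T_L → 0 < T_R → ∀ μ ν : MeasureTheory.Measure (Literature.MathematicalPhysics.KineticTheory.HeatConduction.PhaseSpace N), (Literature.MathematicalPhysics.KineticTheory.HeatConduction.pinnedChain ω₂ lam β γ).IsSteadyState N T_L T_R μ → (Literature.MathematicalPhysics.KineticTheory.HeatConduction.pinnedChain ω₂ lam β γ).IsSteadyState N T_L T_R ν → μ = ν) → ∀ μ : (N : ℕ) → ℝ → ℝ → MeasureTheory.Measure (Literature.MathematicalPhysics.KineticTheory.HeatConduction.PhaseSpace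 N), (∀ (N : ℕ) (T_L T_R : ℝ), 0 < T_L → 0 < T_R → (Literature.MathematicalPhysics.KineticTheory.HeatConduction.pinnedChain ω₂ lam β γ).IsSteadyState N T_L T_R (μ N T_L T_R)) → ∀ T : ℝ, 0 < T → ∀ D : ℕ → ℝ, (∀ N : ℕ, Filter.Tendsto (fun δ : ℝ => (Literature.MathematicalPhysics.KineticTheory.HeatConduction.pinnedChain ω₂ lam β γ).totalCurrent (μ N (T + δ / 2) (T - δ / 2)) / δ) (nhdsWithin 0 {(0 : ℝ)}ᶜ) (nhds (D N))) → ∀ ε : ℝ, 0 < ε → ∀ N₀ : ℕ, ∃ N : ℕ, N₀ ≤ N ∧ D N ≤ ε * ((N : ℝ) - 1)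

/-- item stmt-AtomisticToContinuum-2193 · crux · rank 4 · closed · moot by None · by planner
why it might fail: Asymptotic localisation (DeRoeckHuveneers2015) makes c(T) super-polynomially small but not 0 at fixed T; a genuine failure (D_N→0, thermal insulator) contradicts all numerics yet would refute the conjunct; no N-uniform lower bound on a deterministic chain's NESS current exists in print.
sources: DeRoeckHuveneers2015, BernardinOlla2005, BasileBernardinOlla2009, BonettoLebowitzReyBellet2000, LepriLiviPoliti2003, Dhar2008
[crux] NOT INSULATING: for pinnedChain ω₂ lam β γ (all > 0), under weak-NESS uniqueness, for every
steady-state family, T > 0 and the response coefficients D_N: ∃ c = c(ω₂,lam,β,γ,T) > 0 and N₁ with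
D_N ≥ c for all N ≥ N₁ (liminf_N D_N > 0; equivalently J_N ≥ c·δT/(N−1) to first order: an Ohmic
LOWER bound). NECESSARY for the conjunct (D_N → κ(T) > 0). In the Assembly it caps the Fekete slope:
R_N/N ≤ 1/c, i.e. κ ≥ c. No N-uniform lower bound on the NESS current of a deterministic anharmonic
chain is in print; candidate engines (sibling idea cards): linear-response fluctuation-theorem /
thermodynamic-uncertainty bounds on the conductance from the √t bond-heat variance, comparison with
the energy-conserving-noise chain where κ ≥ c is a theorem (BernardinOlla2005,
BasileBernardinOlla2009), multi-scale pigeonhole on the response temperature profile; ALTERNATIVE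
SUPPLIER inside this route: SubadditiveResistance ∧ PositiveConductance ⇒ R_N ≤ K·N ⇒ D_N ≥ 1/(2K)
(support items). By the scaling conjugacy c(T) may decay super-polynomially in regimes of asymptotic
localisation (DeRoeckHuveneers2015) — allowed at fixed T. -/
@[route_item "route-AtomisticToContinuum-SuperadditiveJunction"]
def ConductanceLowerBound : Prop :=
  ∀ ω₂ lam β γ : ℝ, 0 < ω₂ → 0 < lam → 0 < β → 0 < γ → (∀ (N : ℕ) (T_L T_R : ℝ), 0 < T_L → 0 < T_R → ∀ μ ν : MeasureTheory.Measure (Literature.MathematicalPhysics.KineticTheory.HeatConduction.PhaseSpace N), (Literature.MathematicalPhysics.KineticTheory.HeatConduction.pinnedChain ω₂ lam β γ).IsSteadyState N T_L T_R μ → (Literature.MathematicalPhysics.KineticTheory.HeatConduction.pinnedChain ω₂ lam β γ).IsSteadyState N T_L T_R ν → μ = ν) → ∀ μ : (N : ℕ) → ℝ → ℝ → MeasureTheory.Measure (Literature.MathematicalPhysics.KineticTheory.HeatConduction.PhaseSpace N), (∀ (N : ℕ) (T_L T_R : ℝ), 0 < T_L → 0 < T_R → (Literature.MathematicalPhysics.KineticTheory.HeatConduction.pinnedChain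 ω₂ lam β γ).IsSteadyState N T_L T_R (μ N T_L T_R)) → ∀ T : ℝ, 0 < T → ∀ D : ℕ → ℝ, (∀ N : ℕ, Filter.Tendsto (fun δ : ℝ => (Literature.MathematicalPhysics.KineticTheory.HeatConduction.pinnedChain ω₂ lam β γ).totalCurrent (μ N (T + δ / 2) (T - δ / 2)) / δ) (nhdsWithin 0 {(0 : ℝ)}ᶜ) (nhds (D N))) → ∃ c : ℝ, 0 < c ∧ ∃ N₁ : ℕ, ∀ N : ℕ, N₁ ≤ N → c ≤ D N

/-- item stmt-AtomisticToContinuum-0706 · support · rank 5 · open · by planner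
sources: CuneoEckmannHairerReyBellet2018, Carmona2007
NESS EXISTENCE AND UNIQUENESS for pinnedChain ω₂ lam β γ (all > 0), every N and T_L, T_R > 0, in the
weak Fokker–Planck class IsSteadyState (probability measure, ∫ L f dμ = 0 for f ∈ C_c^∞, bond
currents integrable). From CuneoEckmannHairerReyBellet2018 Thm 2.13 / Carmona2007 (unique invariant
measure of the Langevin SDE, conditions C1–C5 hold since interaction degree 4 ≥ pinning degree 4)
plus identification of weak stationary probability solutions with invariant measures
(hypoellipticity of L*, non-explosion). Degenerate N = 0, 1 included (N = 0: the point mass; N = 1: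
single pinned oscillator with two OU baths). -/
@[route_item "route-AtomisticToContinuum-SuperadditiveJunction"]
def NessExistsUnique : Prop :=
  ∀ ω₂ lam β γ : ℝ, 0 < ω₂ → 0 < lam → 0 < β → 0 < γ → ∀ (N : ℕ) (T_L T_R : ℝ), 0 < T_L → 0 < T_R → ∃ μ : MeasureTheory.Measure (Literature.MathematicalPhysics.KineticTheory.HeatConduction.PhaseSpace N), (Literature.MathematicalPhysics.KineticTheory.HeatConduction.pinnedChain ω₂ lam β γ).IsSteadyState N T_L T_R μ ∧ ∀ ν : MeasureTheory.Measure (Literature.MathematicalPhysics.KineticTheory.HeatConduction.PhaseSpace N), (Literature.MathematicalPhysics.KineticTheory.HeatConduction.pinnedChain ω₂ lam β γ).IsSteadyState N T_L T_R ν → ν = μ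

/-- item stmt-AtomisticToContinuum-0717 · support · rank 5 · closed · proved by Summit.AtomisticToContinuum.FouriersLaw.Theorems.FourierGreenKubo.finiteResponseOfUnique_holds (prover) · by planner
sources: ReyBellet2003, HairerMajda2009, CuneoEckmannHairerReyBellet2018
CONDITIONAL FORM OF 0705 (supersedes it as the prover target; refuters pool-5/g3-0: 0705 stand-alone
quantifies over EVERY steady-state family and is false-prone if weak steady states were non-unique):
assuming UNIQUENESS of weak steady states (IsSteadyState class) for pinnedChain at all N, T_L, T_R >
0, the finite-N linear-response limit D_N(T) = lim_{δ→0, δ≠0} totalCurrent(μ_{N,T+δ/2,T−δ/2})/δ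
exists for every T > 0 and N. Content: differentiability at equilibrium of NESS expectations of the
polynomial currents in the bath temperatures (ReyBellet2003 arXiv:math-ph/0303021 Rem 4.4 (51)–(56)
finite-volume Green–Kubo; HairerMajda2009 arXiv:0909.4313 Thm 2.3 framework — their SDE Thm 4.4
Assumption 5 fails here, so verify Assumptions 1–3 via CEHR2018 (2.5)/Carmona2007 Thm 1.1(iv)
weighted spectral gap). N = 0, 1: totalCurrent ≡ 0, D = 0. Together with 0706 gives 0705. -/
@[route_item "route-AtomisticToContinuum-SuperadditiveJunction"]
def FiniteResponseOfUnique : Prop :=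
  ∀ ω₂ lam β γ : ℝ, 0 < ω₂ → 0 < lam → 0 < β → 0 < γ → (∀ (N : ℕ) (T_L T_R : ℝ), 0 < T_L → 0 < T_R → ∀ μ ν : MeasureTheory.Measure (Literature.MathematicalPhysics.KineticTheory.HeatConduction.PhaseSpace N), (Literature.MathematicalPhysics.KineticTheory.HeatConduction.pinnedChain ω₂ lam β γ).IsSteadyState N T_L T_R μ → (Literature.MathematicalPhysics.KineticTheory.HeatConduction.pinnedChain ω₂ lam β γ).IsSteadyState N T_L T_R ν → μ = ν) → ∀ μ : (N : ℕ) → ℝ → ℝ → MeasureTheory.Measure (Literature.MathematicalPhysics.KineticTheory.HeatConduction.PhaseSpace N), (∀ (N : ℕ) (T_L T_R : ℝ), 0 < T_L → 0 < T_R → (Literature.MathematicalPhysics.KineticTheory.HeatConduction.pinnedChain ω₂ lam β γ).IsSteadyState N T_L T_R (μ N T_L T_R)) → ∀ T : ℝ, 0 < T → ∀ N : ℕ, ∃ D : ℝ, Filter.Tendsto (fun δ : ℝ => (Literature.MathematicalPhysics.KineticTheory.HeatConduction.pinnedChain ω₂ lam β γ).totalCurrent (μ N (T + δ / 2) (T -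 δ / 2)) / δ) (nhdsWithin 0 {(0 : ℝ)}ᶜ) (nhds D)

/-- item stmt-AtomisticToContinuum-2188 · support · rank 6 · closed · moot by None · by planner
sources: ReyBellet2003, KunduDharNarayan2009, EckmannPilletReyBellet1999b
[crux] POSITIVE CONDUCTANCE AT EVERY FINITE LENGTH: under weak-NESS uniqueness, for every
steady-state family, T > 0 and response coefficients D, D_N(T) > 0 for all N ≥ 2 (N = 0, 1 have no
bond, D = 0). Content: the finite-volume Kubo / fluctuation formula D_N = (N−1)T⁻² ∫₀^∞ ⟨j_b(0) Σ_i
j_i(t)⟩_eq dt = lim_t Var(Q_t)/(2tT²) ≥ 0 (ReyBellet2003 Rem 4.4 (56), printed for RBT reservoirs;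
KunduDharNarayan2009 for Langevin baths at physics level) is NON-DEGENERATE: the time-integrated
boundary energy current has diffusive variance because the bath work is not an L²-coboundary of the
equilibrium dynamics; equivalently the strict positivity of entropy production at T_L ≠ T_R
(EckmannPilletReyBellet1999b) survives at first order in δT. Needed so that R_N = (N−1)/D_N ≥
(N−1)/S in the Fekete step (only eventual positivity is necessary for the conjunct; all N ≥ 2 is the
natural fixed-N statement and only D_2 > 0 is used for ℓ < ∞). Fixed-N toolbox:
CuneoEckmannHairerReyBellet2018 Thm 2.13, Carmona2007, HairerMajda2009. -/
@[route_item "route-AtomisticToContinuum-SuperadditiveJunction"]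
def PositiveConductance : Prop :=
  ∀ ω₂ lam β γ : ℝ, 0 < ω₂ → 0 < lam → 0 < β → 0 < γ → (∀ (N : ℕ) (T_L T_R : ℝ), 0 < T_L → 0 < T_R → ∀ μ ν : MeasureTheory.Measure (Literature.MathematicalPhysics.KineticTheory.HeatConduction.PhaseSpace N), (Literature.MathematicalPhysics.KineticTheory.HeatConduction.pinnedChain ω₂ lam β γ).IsSteadyState N T_L T_R μ → (Literature.MathematicalPhysics.KineticTheory.HeatConduction.pinnedChain ω₂ lam β γ).IsSteadyState N T_L T_R ν → μ = ν) → ∀ μ : (N : ℕ) → ℝ → ℝ → MeasureTheory.Measure (Literature.MathematicalPhysics.KineticTheory.HeatConduction.PhaseSpace N), (∀ (N : ℕ) (T_L T_R : ℝ), 0 < T_L → 0 < T_R → (Literature.MathematicalPhysics.KineticTheory.HeatConduction.pinnedChain ω₂ lam β γ).IsSteadyState N T_L T_R (μ N T_L T_R)) → ∀ T : ℝ, 0 < T → ∀ D : ℕ → ℝ, (∀ N : ℕ, Filter.Tendsto (fun δ : ℝ => (Literature.MathematicalPhysics.KineticTheory.HeatConduction.pinnedChain ω₂ lam β γ).totalCurrent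 (μ N (T + δ / 2) (T - δ / 2)) / δ) (nhdsWithin 0 {(0 : ℝ)}ᶜ) (nhds (D N))) → ∀ N : ℕ, 2 ≤ N → 0 < D N

/-- item stmt-AtomisticToContinuum-2186 · support · rank 9 · closed · moot by None · by planner
sources: ArmstrongKuusiMourrat2019, LandimMarianiSeo2018, KunduDharNarayan2009, Hammersley1988
[crux] QUASI-SUBADDITIVITY OF THE LINEAR-RESPONSE RESISTANCE IN THE LENGTH (series law with bounded
junction defect). For pinnedChain ω₂ lam β γ (all > 0), under weak-NESS uniqueness, for every
steady-state family, every T > 0 and the response coefficients D N = lim_{δ→0,δ≠0} totalCurrent(μ N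
(T+δ/2) (T−δ/2))/δ: ∃ C(T) ∀ N, M ≥ 2, (N+M−1)/D_{N+M} ≤ (N−1)/D_N + (M−1)/D_M + C. Here R_N :=
(N−1)/D_N = 1/G_N is the bath-to-bath resistance (physical normalisation; the card's N/D_N differs
by R_N/(N−1) = O(1) under this very crux), and R_N + R_M is EXACTLY the resistance of
(N-chain)–(ideal reservoir at the self-consistent temperature)–(M-chain): replacing the intermediate
reservoir by a direct anharmonic bond raises the resistance by at most a contact constant. Engines:
(a) reservoir-insertion / Büttiker-probe comparison through the open-chain Kubo formula D_N =
(N−1)T⁻² ∫₀^∞ ⟨j_b(0) Σ_i j_i(t)⟩_eq dt (KunduDharNarayan2009; ReyBellet2003 Rem 4.4 (56)) and the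
parity formula for the derivative in the strength of an added bath; (b) gluing admissible trial
pairs in a Dirichlet–Thomson (min–max) representation of ⟨h,(−L)⁻¹h⟩ for L = A_H + γS_baths
(LandimMarianiSeo2018; ArmstrongKuusiMourra -/
@[route_item "route-AtomisticToContinuum-SuperadditiveJunction"]
def QuasiSubadditiveResistance : Prop :=
  ∀ ω₂ lam β γ : ℝ, 0 < ω₂ → 0 < lam → 0 < β → 0 < γ → (∀ (N : ℕ) (T_L T_R : ℝ), 0 < T_L → 0 < T_R → ∀ μ ν : MeasureTheory.Measure (Literature.MathematicalPhysics.KineticTheory.HeatConduction.PhaseSpace N), (Literature.MathematicalPhysics.KineticTheory.HeatConduction.pinnedChain ω₂ lam β γ).IsSteadyState N T_L T_R μ → (Literature.MathematicalPhysics.KineticTheory.HeatConduction.pinnedChain ω₂ lam β γ).IsSteadyState N T_L T_R ν → μ = ν) → ∀ μ : (N : ℕ) → ℝ → ℝ → MeasureTheory.Measure (Literature.MathematicalPhysics.KineticTheory.HeatConduction.PhaseSpace N), (∀ (N : ℕ) (T_L T_R : ℝ), 0 < T_L → 0 < T_R → (Literature.MathematicalPhysics.KineticTheory.HeatConduction.pinnedChain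 ω₂ lam β γ).IsSteadyState N T_L T_R (μ N T_L T_R)) → ∀ T : ℝ, 0 < T → ∀ D : ℕ → ℝ, (∀ N : ℕ, Filter.Tendsto (fun δ : ℝ => (Literature.MathematicalPhysics.KineticTheory.HeatConduction.pinnedChain ω₂ lam β γ).totalCurrent (μ N (T + δ / 2) (T - δ / 2)) / δ) (nhdsWithin 0 {(0 : ℝ)}ᶜ) (nhds (D N))) → ∃ C : ℝ, ∀ N M : ℕ, 2 ≤ N → 2 ≤ M → ((N + M - 1 : ℕ) : ℝ) / D (N + M) ≤ ((N - 1 : ℕ) : ℝ) / D N + ((M - 1 : ℕ) : ℝ) / D M + C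

/-- item stmt-AtomisticToContinuum-2195 · support · rank 9 · closed · moot by None · by planner
sources: Hammersley1988
[support] FEKETE GLUE (pure real analysis, the lemma the Assembly proof needs; ~60 Lean lines): for
a real sequence D with D_N > 0 (N ≥ 2), eventually D_N ≥ c > 0, superadditivity of the resistances
R_N := (N−1)/D_N up to the constant C on {N, M ≥ 2}, and liminf D_N/(N−1) ≤ 0, the sequence D
converges to some κ > 0. Proof: a_N := R_N − C satisfies a_{N+M} ≥ a_N + a_M (N, M ≥ 2); for fixed m
≥ 2 write N = qm + r with r ∈ {2,…,m+1} to get a_N ≥ q·a_m + a_r, hence liminf a_N/N ≥ a_m/m for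
every m, so a_N/N → ℓ := sup_{m≥2} a_m/m ∈ (−∞, ∞]; the non-ballistic hypothesis gives R_N ≥ 1/ε
frequently, so some a_{N₀} > 0 and ℓ > 0; D_N ≥ c eventually gives a_N/N ≤ (N−1)/(cN) so ℓ ≤ 1/c;
then R_N/N → ℓ ∈ (0, 1/c] and D_N = ((N−1)/N)/(R_N/N) → 1/ℓ =: κ ≥ c > 0. Mathlib has the
subadditive version (Subadditive.tendsto_lim, Mathlib/Analysis/Subadditive.lean) on index set ℕ; the
restriction to {N ≥ 2} and the sign flip are the only work. -/
@[route_item "route-AtomisticToContinuum-SuperadditiveJunction"]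
def SuperadditiveFekete : Prop :=
  ∀ (D : ℕ → ℝ) (C c : ℝ), 0 < c → (∀ N : ℕ, 2 ≤ N → 0 < D N) → (∃ N₁ : ℕ, ∀ N : ℕ, N₁ ≤ N → c ≤ D N) → (∀ N M : ℕ, 2 ≤ N → 2 ≤ M → ((N : ℝ) - 1) / D N + ((M : ℝ) - 1) / D M - C ≤ ((N : ℝ) + (M : ℝ) - 1) / D (N + M)) → (∀ ε : ℝ, 0 < ε → ∀ N₀ : ℕ, ∃ N : ℕ, N₀ ≤ N ∧ D N ≤ ε * ((N : ℝ) - 1)) → ∃ κ : ℝ, 0 < κ ∧ Filter.Tendsto D Filter.atTop (nhds κ)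

/-- item stmt-AtomisticToContinuum-2196 · support · rank 9 · closed · moot by None · by planner
sources: LepriLiviPoliti2003, doi:10.1103/physrevlett.86.4029
[support] JUNCTION DICHOTOMY WITH RATE (pure real analysis; the route's refutation interface): if
D_N > 0 for N ≥ 2 and R_N := (N−1)/D_N satisfies TWO-SIDED locality |R_{N+M} − R_N − R_M| ≤ C (N, M
≥ 2), then EITHER ∃ κ > 0, K with |D_N − κ| ≤ K/N for all N ≥ 2 (Fourier's law with the 1/N
finite-size rate) OR D_N ≥ (N−1)/C for all N ≥ 2 (ballistic branch: bounded resistance, where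
pinnedChain ω₂ 0 0 γ sits). Proof: R_N − C superadditive and R_N + C subadditive on {N ≥ 2} give
R_N/N → ℓ with |R_N − Nℓ| ≤ C for every N ≥ 2 and ℓ ≥ 0 (C ≥ 0 forced). ℓ = 0: 0 < R_N ≤ C, D_N ≥
(N−1)/C. ℓ > 0, κ := 1/ℓ: |D_N − κ| = |(N−1)ℓ − R_N|/(ℓR_N) ≤ 2(C + ℓ)/(ℓ²N) once Nℓ ≥ 2C; finitely
many small N are absorbed into K. So anomalous scalings D_N ~ N^α (0 < α < 1) and localisation are
excluded structurally by two-sided locality; pinned anharmonic chains numerically show exactly 1/N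
corrections (boundary jumps: LepriLiviPoliti2003 §6; Aoki–Kusnezov doi:10.1103/physrevlett.86.4029)
— the cheapest consistency check of the line. -/
@[route_item "route-AtomisticToContinuum-SuperadditiveJunction"]
def JunctionDichotomy : Prop :=
  ∀ (D : ℕ → ℝ) (C : ℝ), (∀ N : ℕ, 2 ≤ N → 0 < D N) → (∀ N M : ℕ, 2 ≤ N → 2 ≤ M → |((N : ℝ) + (M : ℝ) - 1) / D (N + M) - ((N : ℝ) - 1) / D N - ((M : ℝ) - 1) / D M| ≤ C) → (∃ κ K : ℝ, 0 < κ ∧ ∀ N : ℕ, 2 ≤ N → |D N - κ| ≤ K / (N : ℝ)) ∨ (∀ N : ℕ, 2 ≤ N → ((N : ℝ) - 1) / C ≤ D N)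

/-- item stmt-AtomisticToContinuum-2197 · support · rank 9 · closed · moot by None · by planner
sources: RoyDhar2008, BonettoLebowitzReyBellet2000
[support] HARMONIC CALIBRATION (sign/normalisation regression test at the integrable corner,
provable in tree): for the pinned HARMONIC chain pinnedChain ω₂ 0 0 γ (ω₂, γ > 0) there is a
steady-state family for all N, T_L, T_R > 0 (the Gaussian states harmonicNESS,
isSteadyState_harmonicNESS in HarmonicChainNESS.lean) along which, at every T > 0, the response
limits exist and equal D_N = (N−1)·fluxCoeff ω₂ γ N (integral_bondCurrent_harmonicNESS_eq_fluxCoeff: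
every bond carries fluxCoeff·(T_L − T_R), cf. HarmonicChainBallisticFlux_holds and .ballisticLaw),
D_N > 0 for N ≥ 2 (fluxCoeff_eq: c_N = γ/(2(1+γ²))·(r + r^{2N−2})/(1 + r^{2N−1}) with 0 < r = rootR
< 1), the resistances R_N = 1/fluxCoeff_N satisfy TWO-SIDED junction locality (trivially, with C =
3·sup_N 1/c_N < ∞ since c_N → fluxLimit > 0, tendsto_fluxCoeff) and are BOUNDED. So the ballistic
member satisfies SuperadditiveResistance and SubadditiveResistance and violates exactly
NonBallistic: the route cannot prove too much, and the (N : ℝ) − 1 / N + M − 1 normalisations of the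
items are exercised on a closed form. Uniqueness of the harmonic weak NESS is not claimed (statement
along one explicit family). -/
@[route_item "route-AtomisticToContinuum-SuperadditiveJunction"]
def HarmonicCalibration : Prop :=
  ∀ ω₂ γ : ℝ, 0 < ω₂ → 0 < γ → ∃ μ : (N : ℕ) → ℝ → ℝ → MeasureTheory.Measure (Literature.MathematicalPhysics.KineticTheory.HeatConduction.PhaseSpace N), (∀ (N : ℕ) (T_L T_R : ℝ), 0 < T_L → 0 < T_R → (Literature.MathematicalPhysics.KineticTheory.HeatConduction.pinnedChain ω₂ 0 0 γ).IsSteadyState N T_L T_R (μ N T_L T_R)) ∧ ∀ T : ℝ, 0 < T → ∃ D : ℕ → ℝ, (∀ N : ℕ, Filter.Tendsto (fun δ : ℝ => (Literature.MathematicalPhysics.KineticTheory.HeatConduction.pinnedChain ω₂ 0 0 γ).totalCurrent (μ N (T + δ / 2) (T - δ / 2)) / δ) (nhdsWithin 0 {(0 : ℝ)}ᶜ) (nhds (D N))) ∧ (∀ N : ℕ, 2 ≤ N → 0 < D N) ∧ (∃ C : ℝ, ∀ N M : ℕ, 2 ≤ N → 2 ≤ M → |((N : ℝ) + (M : ℝ)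 - 1) / D (N + M) - ((N : ℝ) - 1) / D N - ((M : ℝ) - 1) / D M| ≤ C) ∧ (∃ B : ℝ, ∀ N : ℕ, 2 ≤ N → ((N : ℝ) - 1) / D N ≤ B)

/-- item stmt-AtomisticToContinuum-2198 · assembly · rank 1 · closed · moot by None · by planner
sources: BonettoLebowitzReyBellet2000
[assembly] X_SJ ⇒ FouriersLaw. Given the six hypotheses, fix parameters > 0; NessExistsUnique gives
clause (i) and (by choice, junk measure at non-positive temperatures) one steady-state family μ₀
plus uniqueness in the (μ ν)-form; for T > 0, FiniteResponseOfUnique gives D⁰_N(T) for every N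
(choice); PositiveConductance, ConductanceLowerBound, SuperadditiveResistance (fed the positivity)
and NonBallistic applied to (μ₀, T, D⁰(T)) are exactly the hypotheses of the real-analysis lemma
SuperadditiveFekete (support item; prove it inline or import its Theorems file), yielding κ_T > 0
with D⁰(T) → κ_T; set κ T := κ_T for T > 0 (else 1). For an arbitrary steady-state family μ,
uniqueness gives μ N a b = μ₀ N a b for a, b > 0, so the difference quotients agree eventually along
𝓝[≠] 0 (|δ| < 2T) and D⁰(T) serves as its response sequence (Filter.Tendsto.congr', as in
Literature.Barriers.AtomisticToContinuum.hasBoundedResponse_iff_of_unique); conclude with the landed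
frame Literature.HeatConduction.fouriersLaw_of_steadyState_and_linearResponse
(Theorems/FourierGreenKuboAssembly.lean). -/
@[route_item "route-AtomisticToContinuum-SuperadditiveJunction"]
def Assembly : Prop :=
  NessExistsUnique → FiniteResponseOfUnique → PositiveConductance → ConductanceLowerBound → SuperadditiveResistance → NonBallistic → Literature.MathematicalPhysics.KineticTheory.HeatConduction.FouriersLaw

end Summit.AtomisticToContinuum.FouriersLaw.Theses.SuperadditiveJunction
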